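import Literature.Analysis.FluidPDE.PineauVicolRSSHolds
import HarnessLib

/-!
# Crux `NoTypeIBlowup` (stmt-NavierStokesRegularity-1217), line `killing-twisted-bernoulli-solitons`:
  stub `rssStratum_axisymmetric_of_two_speeds` (one profile, two rotation speeds ⇒ axisymmetric)

Mirror-symmetric stratum of Pineau–Vicol, Conjecture 1.1 (arXiv:2607.09619): a mirror-symmetric
Type-I rotating self-similar profile `U` produces the rotated self-similar ansatz fields
`pvAnsatz α U` and `pvAnsatz (−α) U` ((1.7): `u(x,t) = (−t)^{−1/2} R(αs) U(R(−αs) x/√(−t))`,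
`s = −log(−t)`, `R(θ) = rotZ θ`), which coincide on `t ∈ (−1, −1/2)` by forward uniqueness. This
file is the purely algebraic step: if the ansatz fields of ONE profile `U` at two DIFFERENT speeds
`α ≠ β` coincide for `t ∈ (−1, −1/2)`, then `U` is axisymmetric.

* `RssStratumTwoSpeeds.equivariant_of_two_speeds` — evaluating the coincidence at the time
  `t = −e^{−σ}` (`σ ∈ (0, log 2)`, so `s = σ`) and the point `x = √(−t) · R(βσ) y`, cancelling the
  common factor `(−t)^{−1/2}` and the rotations, gives `U (R_φ y) = R_φ (U y)` for
  `φ = (β − α) σ`.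
* `RssStratumTwoSpeeds.equivariant_zero/add/neg/nat_mul` — the set of angles `φ` with
  `U ∘ R_φ = R_φ ∘ U` is an additive subgroup of `ℝ` (`rotZ_zero`, `rotZ_add`).
* `RssStratumTwoSpeeds.equivariant_of_abs_lt`, `RssStratumTwoSpeeds.equivariant_all` — a subgroup
  of `ℝ` containing the interval `(β − α) · (0, log 2)` contains `(−|β − α| log 2, |β − α| log 2)`
  (differences) and hence, by the Archimedean property, every angle.
* `rssStratum_axisymmetric_of_two_speeds` — the registered statement.

Lands `--supports stmt-NavierStokesRegularity-1217`.
-/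

noncomputable section

set_option linter.dupNamespace false

namespace Summit.NavierStokesRegularity.NavierStokesRegularity.Theorems

open Literature.Analysis.FluidPDE Set

namespace RssStratumTwoSpeeds

/-- The angle `0` is an equivariance angle of every field: `U (R_0 y) = R_0 (U y)`. [folklore] -/
theorem equivariant_zero (U : EuclideanSpace ℝ (Fin 3) → EuclideanSpace ℝ (Fin 3))
    (y : EuclideanSpace ℝ (Fin 3)) : U (rotZ 0 y) = rotZ 0 (U y) := by
  rw [rotZ_zero, rotZ_zero]

/-- Equivariance angles are closed under addition (`R_{φ+ψ} = R_φ R_ψ`). [folklore] -/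
theorem equivariant_add {U : EuclideanSpace ℝ (Fin 3) → EuclideanSpace ℝ (Fin 3)} {φ ψ : ℝ}
    (hφ : ∀ y, U (rotZ φ y) = rotZ φ (U y)) (hψ : ∀ y, U (rotZ ψ y) = rotZ ψ (U y))
    (y : EuclideanSpace ℝ (Fin 3)) : U (rotZ (φ + ψ) y) = rotZ (φ + ψ) (U y) := by
  rw [rotZ_add, hφ, hψ, rotZ_add]

/-- Equivariance angles are closed under negation (`R_{−φ} = R_φ⁻¹`). [folklore] -/
theorem equivariant_neg {U : EuclideanSpace ℝ (Fin 3) → EuclideanSpace ℝ (Fin 3)} {φ : ℝ}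
    (hφ : ∀ y, U (rotZ φ y) = rotZ φ (U y)) (y : EuclideanSpace ℝ (Fin 3)) :
    U (rotZ (-φ) y) = rotZ (-φ) (U y) := by
  have h := hφ (rotZ (-φ) y)
  rw [← rotZ_add, add_neg_cancel, rotZ_zero] at h
  rw [h, ← rotZ_add, neg_add_cancel, rotZ_zero]

/-- Equivariance angles are closed under natural multiples. [folklore] -/
theorem equivariant_nat_mul {U : EuclideanSpace ℝ (Fin 3) → EuclideanSpace ℝ (Fin 3)} {ψ : ℝ}
    (hψ : ∀ y, U (rotZ ψ y) = rotZ ψ (U y)) (n : ℕ) (y : EuclideanSpace ℝ (Fin 3)) :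
    U (rotZ (n * ψ) y) = rotZ (n * ψ) (U y) := by
  induction n generalizing y with
  | zero =>
    rw [Nat.cast_zero, zero_mul]
    exact equivariant_zero U y
  | succ n ih =>
    rw [Nat.cast_succ, add_mul, one_mul]
    exact equivariant_add ih hψ y

/-- If every angle of the interval `c · (0, L)` (`c ≠ 0`) is an equivariance angle, then so is
every angle `θ` with `|θ| < |c| L`: write `θ = c (L/2 + θ/(2c)) − c (L/2 − θ/(2c))`. [folklore] -/
theorem equivariant_of_abs_lt {U : EuclideanSpace ℝ (Fin 3) → EuclideanSpace ℝ (Fin 3)} {c L : ℝ}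
    (hc : c ≠ 0) (H : ∀ σ ∈ Set.Ioo (0 : ℝ) L, ∀ y, U (rotZ (c * σ) y) = rotZ (c * σ) (U y))
    {θ : ℝ} (hθ : |θ| < |c| * L) (y : EuclideanSpace ℝ (Fin 3)) :
    U (rotZ θ y) = rotZ θ (U y) := by
  have hc' : 0 < |c| := abs_pos.2 hc
  have hσ : |θ / c| < L := by
    rw [abs_div, div_lt_iff₀ hc']
    linarith
  obtain ⟨h1, h2⟩ := abs_lt.1 hσ
  have e : θ = c * (L / 2 + θ / c / 2) + -(c * (L / 2 - θ / c / 2)) := by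
    have hcc : c * (θ / c) = θ := mul_div_cancel₀ θ hc
    linear_combination -hcc
  rw [e]
  exact equivariant_add (H _ ⟨by linarith, by linarith⟩)
    (equivariant_neg (H _ ⟨by linarith, by linarith⟩)) y

/-- If every angle of an interval `c · (0, L)` (`c ≠ 0`, `L > 0`) is an equivariance angle, then
every angle is (Archimedes: `θ = n · (θ/n)` with `|θ/n| < |c| L`). [folklore] -/
theorem equivariant_all {U : EuclideanSpace ℝ (Fin 3) → EuclideanSpace ℝ (Fin 3)} {c L : ℝ}
    (hc : c ≠ 0) (hL : 0 < L)
    (H : ∀ σ ∈ Set.Ioo (0 : ℝ) L, ∀ y, U (rotZ (c * σ) y) = rotZ (c * σ) (U y))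
    (θ : ℝ) (y : EuclideanSpace ℝ (Fin 3)) : U (rotZ θ y) = rotZ θ (U y) := by
  have hδ : 0 < |c| * L := mul_pos (abs_pos.2 hc) hL
  obtain ⟨n, hn⟩ := exists_nat_gt (|θ| / (|c| * L))
  have hn0 : (0 : ℝ) < n := lt_of_le_of_lt (div_nonneg (abs_nonneg θ) hδ.le) hn
  rw [div_lt_iff₀ hδ] at hn
  have hsmall : |θ / n| < |c| * L := by
    rw [abs_div, Nat.abs_cast, div_lt_iff₀ hn0]
    linarith
  have key := equivariant_nat_mul (equivariant_of_abs_lt hc H hsmall) n y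
  rwa [mul_div_cancel₀ θ hn0.ne'] at key

/-- **The key computation.** If the rotated self-similar ansatz fields of one profile `U` at the
speeds `α` and `β` coincide for `t ∈ (−1, −1/2)`, then `U (R_φ y) = R_φ (U y)` for every
`φ = (β − α) σ`, `σ ∈ (0, log 2)`: take `t = −e^{−σ}` (so `−log(−t) = σ`) and
`x = √(−t) · R(βσ) y`, cancel the factor `(−t)^{−1/2}` and compose with `R(−ασ)`. [folklore] -/
theorem equivariant_of_two_speeds {α β : ℝ}
    {U : EuclideanSpace ℝ (Fin 3) → EuclideanSpace ℝ (Fin 3)}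
    (H : ∀ t ∈ Set.Ioo (-1 : ℝ) (-(1 / 2)), ∀ x : EuclideanSpace ℝ (Fin 3),
      pvAnsatz α (fun y _ => U y) t x = pvAnsatz β (fun y _ => U y) t x)
    (σ : ℝ) (hσ : σ ∈ Set.Ioo (0 : ℝ) (Real.log 2)) (y : EuclideanSpace ℝ (Fin 3)) :
    U (rotZ ((β - α) * σ) y) = rotZ ((β - α) * σ) (U y) := by
  have ht : -Real.exp (-σ) ∈ Set.Ioo (-1 : ℝ) (-(1 / 2)) := by
    have h1 : Real.exp (-σ) < 1 := Real.exp_lt_one_iff.2 (by linarith [hσ.1])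
    have h2 : (1 / 2 : ℝ) < Real.exp (-σ) := by
      have e2 : Real.exp (-Real.log 2) = 1 / 2 := by
        rw [Real.exp_neg, Real.exp_log two_pos, one_div]
      rw [← e2, Real.exp_lt_exp]
      linarith [hσ.2]
    constructor <;> linarith
  have hr : 0 < Real.sqrt (Real.exp (-σ)) := Real.sqrt_pos.2 (Real.exp_pos _)
  have h := H _ ht (Real.sqrt (Real.exp (-σ)) • rotZ (β * σ) y)
  simp only [pvAnsatz, neg_neg, Real.log_exp] at h
  rw [inv_smul_smul₀ hr.ne'] at h
  have h' := congrArg (fun v => Real.sqrt (Real.exp (-σ)) • v) h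
  simp only [smul_inv_smul₀ hr.ne'] at h'
  -- `h' : R(ασ) (U (R(−ασ) (R(βσ) y))) = R(βσ) (U (R(−βσ) (R(βσ) y)))`
  rw [← rotZ_add, ← rotZ_add, neg_add_cancel, rotZ_zero] at h'
  have h'' := congrArg (rotZ (-(α * σ))) h'
  rw [← rotZ_add, ← rotZ_add, neg_add_cancel, rotZ_zero] at h''
  have e : (β - α) * σ = -(α * σ) + β * σ := by ring
  rw [e]
  exact h''

end RssStratumTwoSpeeds

/-- **One profile, two rotation speeds ⇒ axisymmetric.** If the Pineau–Vicol rotated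
self-similar ansatz fields `pvAnsatz α U` and `pvAnsatz β U` ((1.7):
`(−t)^{−1/2} R(αs) U(R(−αs) x/√(−t))`, `s = −log(−t)`) of one profile `U` at two different speeds
`α ≠ β` coincide for `t ∈ (−1, −1/2)`, then `U` is axisymmetric, `U (R_θ y) = R_θ (U y)` for all
`θ`: the coincidence makes every `(β − α) σ`, `σ ∈ (0, log 2)`, an equivariance angle of `U`, and
the equivariance angles form a subgroup of `ℝ`, which is all of `ℝ` once it contains a nontrivial
interval. [folklore] -/
theorem rssStratum_axisymmetric_of_two_speeds :
    ∀ (α β : ℝ) (U : EuclideanSpace ℝ (Fin 3) → EuclideanSpace ℝ (Fin 3)), α ≠ β →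
      (∀ t ∈ Set.Ioo (-1 : ℝ) (-(1 / 2)), ∀ x : EuclideanSpace ℝ (Fin 3),
        Literature.Analysis.FluidPDE.pvAnsatz α (fun y _ => U y) t x =
          Literature.Analysis.FluidPDE.pvAnsatz β (fun y _ => U y) t x) →
      Literature.Analysis.FluidPDE.IsAxisymmetric U := by
  intro α β U hαβ H θ y
  have hc : β - α ≠ 0 := sub_ne_zero.2 hαβ.symm
  exact RssStratumTwoSpeeds.equivariant_all hc (Real.log_pos one_lt_two)
    (RssStratumTwoSpeeds.equivariant_of_two_speeds H) θ y

end Summit.NavierStokesRegularity.NavierStokesRegularity.Theorems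

end
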